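import Mathlib
import HarnessLib
import Summits.Langlands.Statement
import Summits.Langlands.Langlands.Theses.WachComponentCensus
import Literature.NumberTheory.Automorphic.IsAutomorphicAE
import Literature.NumberTheory.Automorphic.HilbertModularGaloisRep
import Literature.NumberTheory.Automorphic.HilbertModularLocalGlobal
import Literature.NumberTheory.Automorphic.HilbertModularLocalGlobalPinned
import Literature.NumberTheory.Automorphic.FontaineMazurHilbertTotallySplit
import Literature.NumberTheory.Automorphic.AlgebraicityTwist
import Literature.NumberTheory.Automorphic.AutomorphicTwistNorm
import Literature.NumberTheory.Automorphic.ArchParameterUnique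
import Literature.NumberTheory.PAdicHodge.FontaineDpst

/-!
# `LiftB2UnramSplitP` (item stmt-Langlands-12044, support of route `WachComponentCensus`) from the
# printed theorems: the exact trust base of the "calibration anchor"

The route decl `Summit.Langlands.Langlands.Theses.WachComponentCensus.LiftB2UnramSplitP` — the
(B)-direction lifting slice for `n = 2` over a totally real `F` at a prime `p ≥ 7` that SPLITS
COMPLETELY in `F`, of shape `∃ RD : ReciprocityData F, pin ∧ ∀ hcpt, (A)₂ ∧ (B)` — is "KNOWN in
print" (item text: Kisin 2009 + Paškūnas + Hu–Tan).  It is not provable outright in the tree (no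
term of `ReciprocityData F` without the local Langlands correspondence; (A)₂ and (B) are XL
published theorems; the pin speaks about Fontaine's datum pinned BY SPECIFICATION), so this file
proves it from NAMED FACTS, making the trust base explicit and typed:

* `liftB2UnramSplitP_of_pinned_facts` —
  `hpin` (Hodge–Tate weights of the powers of the cyclotomic character for the PINNED datum, see
  below) → lang.S27 `exists_galoisRep_of_regularAlgebraic` (Harris–Lan–Taylor–Thorne/Scholze; for
  `n = 2` Carayol–Taylor–Blasius–Rogawski) → `galoisRep_GL2_totallyReal_irreducible` (Ribet;
  Skinner 2009 §2.4.2) → `galoisRep_GL2_totallyReal_localGlobal_pinned` (Carayol, Taylor,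
  Blasius–Rogawski, Saito, Skinner 2009 Thm. 1: local–global compatibility at every finite place,
  for Harris–Taylor's `rec_v` normalised against THE local Artin maps — the pinned re-vendoring
  `HilbertModularLocalGlobalPinned` of the accepted fact, carrying the two canonicity conjuncts
  `(llc v).artin.IsCanonical`, `((llc v).eps.artin E).IsCanonical` that the re-typed three-field
  `ReciprocityData` (2026-08-16/17) demands) → `HuTan2015_theorem63` (Kisin 2009 Thm. (2.2.18) +
  Paškūnas 2015 + Hu–Tan 2015 Thm. 6.3: modularity at a totally split `p ≥ 5`) →
  `LiftB2UnramSplitP`.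
  The reciprocity datum is `RD := ⟨llc, hcan, hcanE⟩` for the Harris–Taylor family `llc` and its
  two pins produced by the local–global fact; `RD.pst p v hv` is Fontaine's pinned
  `fontainePstAdicCompletion v p hv` by `rfl`, so the (B)-hypotheses of the route decl are
  literally those of `HuTan2015_theorem63` and the conclusion `Corresponds RD ι π ρ` is literally
  "attached a.e. ∧ compatible everywhere".  The former `liftB2UnramSplitP_of_facts` (same proof
  from the UNPINNED `galoisRep_GL2_totallyReal_localGlobal`, which cannot fill the two new fields)
  is kept as a `@[deprecated]` alias: Theorems files are append-only.
* `exists_irreducible_satakeFrobCompatibleAE_GL2` — the `L`-normalised existence statement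
  needed for (A)₂, DERIVED (not assumed) from lang.S27 and Ribet's irreducibility by the
  half-twist `π ↦ π ⊗ |det|^{1/2}` (`CuspidalAutomorphicRepData.exists_twist_hasInfinityType`,
  `HasSatakeParamAt.of_map_mulChar_detTwist_of_cpow`, `HasInfinityType.map_a_eq`): for an
  `L`-algebraic cuspidal `π` on `GL₂(𝔸_K)` with a regular infinity type there is an irreducible
  `r : Γ_K → GL₂(ℚ̄_ℓ)` with `SatakeFrobCompatibleAE ι π.1 r`
  (`q_v^{1/2} · (q_v^{-1/2} α_j) = α_j` turns `arithFrobPolyOfSatake ι q_v 2 ·` into `· ι q_v 1 ·`).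

## The pin is NOT derivable from the specification of Fontaine's datum (recorded gap)

The first conjunct of the route decl, `HT_τ(χ) = {-m}` for every rank-one `χ` with entries
`ε^m` and every `ℚ_p`-embedding `τ` of `F_v`, is a theorem for the genuine `B_dR` (Fontaine,
Exp. III §1.5; Barnet-Lamb–Gee–Geraghty–Taylor, Notation: `HT_τ(ε_l) = {-1}`), but the datum of the
summit is `Classical.epsilon` over the clauses (F1)–(F7) of `IsFontaineDatum`
(`Literature/NumberTheory/PAdicHodge/FontaineDpst`), and those clauses constrain only the
UNLABELLED weight of `ε` itself ((F2) `CyclotomicWeightNegOne`) and of unramified representations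
((F3)): nothing about `ε^m`, `|m| ≥ 2` or `m = -1`, and nothing about labelled weights.  By the
module docstring of `FontaineDpst` ("a statement about `fontainePst` is provable exactly when it
holds for EVERY datum satisfying the clauses") the pin is therefore taken here as the hypothesis
`hpin`, to be discharged by a literature seat ADDING the clause
"(F8) `∀ m χ τ, 𝔇.𝔅.labelledHodgeTateWeights χ τ = {-m}` for `χ` with entries `ε^m`" to
`IsFontaineDatum` (the designed upgrade path) — after which `hpin` follows from
`FontaineDatumExists`.  The SAME pin is the first conjunct of the route's target `LiftB2Unram`,
of its cruxes `LiftB2UnramSmallF` / `LiftB2UnramLargeF`, and of the slices of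
`TriangulineChamber`; all of them inherit this gap.

No statement of the route file is altered; the route decl is used BY NAME.  Conditional result
(`--supports stmt-Langlands-12044`): axioms `propext`, `Classical.choice`, `Quot.sound`; trust base
= the four named facts (the local–global one in its pinned form) + `hpin`.
-/

noncomputable section

set_option linter.dupNamespace false -- project-wide option; `Summit.Langlands.Langlands` is the mandated namespace

open scoped MatrixGroups Matrix NumberField
open NumberField IsDedekindDomain Field Filter Polynomial

namespace Summit.Langlands.Langlands.Theorems

open Literature.NumberTheory.Automorphic Literature.NumberTheory.GaloisRepresentations
open Literature.NumberTheory.PAdicHodge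

/-- **Galois representations of `L`-algebraic regular cuspidal `π` on `GL₂` over a totally real
field, in Buzzard–Gee's `L`-normalisation** — from lang.S27 (`exists_galoisRep_of_regularAlgebraic`,
Carayol–Taylor–Blasius–Rogawski for `n = 2`) and Ribet's irreducibility
(`galoisRep_GL2_totallyReal_irreducible`), by the half-twist `π ↦ π ⊗ |det|^{1/2}` (a regular
algebraic cuspidal representation: `exists_twist_hasInfinityType`,
`isCAlgebraic_iff_isLAlgebraic_twist`, `HasInfinityType.map_a_eq`; Satake parameters scale by
`q_v^{-1/2}`, `HasSatakeParamAt.of_map_mulChar_detTwist_of_cpow`): there is an irreducible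
continuous `r : Γ_K → GL₂(ℚ̄_ℓ)` such that at almost every finite place `v`, `π` has a Satake
parameter `α`, `r` is unramified and the arithmetic Frobenius has characteristic polynomial
`∏ (X - ι⁻¹(α_j⁻¹))` (`SatakeFrobCompatibleAE`).  Proved glue, conditional on the two named facts.
[cite: BuzzardGeeLMS2014, Conj. 3.2.2 and §5.3] -/
theorem exists_irreducible_satakeFrobCompatibleAE_GL2
    (h27 : exists_galoisRep_of_regularAlgebraic) (hirr : galoisRep_GL2_totallyReal_irreducible)
    {K : Type} [Field K] [NumberField K] [hK : IsTotallyReal K]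
    {hcpt : isCompact_glFiniteIntegralLevel 2 K} (π : CuspidalAutomorphicRepData 2 K hcpt)
    (hL : π.1.IsLAlgebraic) (hreg : ∃ T : InfinityType K 2, π.1.HasInfinityType T ∧ T.IsRegular)
    (ℓ : ℕ) [Fact ℓ.Prime] (ι : PadicAlgCl ℓ ≃+* ℂ) :
    ∃ r : FramedGaloisRep K (PadicAlgCl ℓ) 2,
      r.toGaloisRep.IsIrreducible ∧ SatakeFrobCompatibleAE ι π.1 r := by
  obtain ⟨T', hT', hT'L⟩ := hL
  obtain ⟨T, hT, hTreg⟩ := hreg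
  -- the `a`-multisets of two infinity types of `π` agree, so `T'` is regular as well
  have hT'reg : T'.IsRegular := fun σ => by
    rw [← AutomorphicRepData.HasInfinityType.map_a_eq π.1 hT hT' σ]
    exact hTreg σ
  -- the half-twist `πt = π ⊗ |det|^{1/2}` is regular algebraic (Clozel)
  obtain ⟨χ, πt, hχ, hW, hW', hPiT⟩ := π.exists_twist_hasInfinityType (1 / 2 : ℝ) hT'
  have hPialg : πt.1.IsRegularAlgebraic := by
    refine ⟨T'.twist ((1 / 2 : ℝ) : ℂ), hPiT, ?_, hT'reg.twist _⟩
    rw [InfinityType.isCAlgebraic_iff_isLAlgebraic_twist, InfinityType.twist_twist]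
    convert (InfinityType.isLAlgebraic_twist_intCast_iff T' 1).mpr hT'L using 2
    push_cast
    ring
  obtain ⟨r, hrirr, hr⟩ :=
    exists_irreducible_galoisRep_GL2_totallyReal h27 hirr hcpt hK πt hPialg ℓ ι
  refine ⟨r, hrirr, ?_⟩
  -- the finitely many places above `ℓ`
  have hℓ0 : Ideal.span {((ℓ : ℕ) : 𝓞 K)} ≠ ⊥ := by
    rw [Ne, Ideal.span_singleton_eq_bot]
    exact_mod_cast (Fact.out : ℓ.Prime).ne_zero
  have hfin : ∀ᶠ v : HeightOneSpectrum (𝓞 K) in cofinite, ((ℓ : ℕ) : 𝓞 K) ∉ v.asIdeal := by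
    rw [Filter.eventually_cofinite]
    refine (Ideal.finite_factors hℓ0).subset fun v hv => ?_
    simp only [Set.mem_setOf_eq, not_not] at hv
    exact Ideal.dvd_span_singleton.mpr hv
  have hunr : ∀ᶠ v : HeightOneSpectrum (𝓞 K) in cofinite, π.1.IsUnramifiedAt v :=
    π.1.hasSatakeParamAt_cofinite_holds
  have hq : ∀ v : HeightOneSpectrum (𝓞 K), (v.residueCard : ℂ) ≠ 0 := fun v =>
    Nat.cast_ne_zero.mpr (lt_trans zero_lt_one v.one_lt_residueCard).ne'
  unfold SatakeFrobCompatibleAE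
  filter_upwards [hunr, hfin] with v hv hvℓ
  obtain ⟨α, hα⟩ := hv
  have hPiα := AutomorphicRepData.HasSatakeParamAt.of_map_mulChar_detTwist_of_cpow hχ hW hW' hα
  obtain ⟨hur, hcp⟩ := hr v _ hPiα hvℓ
  refine ⟨α, hα, hur, ?_⟩
  -- `∏ (X - ι⁻¹((q^{1/2} · q^{-1/2} a)⁻¹)) = ∏ (X - ι⁻¹(a⁻¹))`
  have hs : ((Real.sqrt (v.residueCard : ℝ) : ℝ) : ℂ) =
      (v.residueCard : ℂ) ^ (((1 / 2 : ℝ) : ℝ) : ℂ) := by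
    rw [Real.sqrt_eq_rpow, Complex.ofReal_cpow (Nat.cast_nonneg _)]
    push_cast
    rfl
  have key : arithFrobPolyOfSatake ι v.residueCard 2
      (α.map (((v.residueCard : ℂ) ^ (-(((1 / 2 : ℝ) : ℝ) : ℂ))) * ·)) =
      arithFrobPolyOfSatake ι v.residueCard 1 α := by
    unfold arithFrobPolyOfSatake
    rw [Multiset.map_map]
    congr 1
    refine Multiset.map_congr rfl fun a _ => ?_
    simp only [Function.comp_apply]
    congr 3
    rw [hs, show (2 - 1 : ℕ) = 1 from rfl, show (1 - 1 : ℕ) = 0 from rfl, pow_one, pow_zero,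
      one_mul, ← mul_assoc, ← Complex.cpow_add _ _ (hq v), add_neg_cancel, Complex.cpow_zero,
      one_mul]
  rw [← key]
  exact hcp

/-- **`LiftB2UnramSplitP` from the printed theorems** (module docstring): the (B)-direction
lifting slice of route `WachComponentCensus` for `n = 2` over a totally real `F` at a totally
split prime `p ≥ 7`, proved from
* `hpin` — the Hodge–Tate pin for Fontaine's PINNED datum (`HT_τ(ε^m) = {-m}` at every `v ∣ p`
  and every `ℚ_p`-embedding `τ`; a theorem for `B_dR`, Fontaine Exp. III §1.5, awaiting the
  clause (F8) of `IsFontaineDatum` — see the module docstring),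
* lang.S27 `exists_galoisRep_of_regularAlgebraic` and Ribet's
  `galoisRep_GL2_totallyReal_irreducible` (existence and irreducibility of `r_{π,ι}`),
* `galoisRep_GL2_totallyReal_localGlobal_pinned` (Carayol, Taylor, Blasius–Rogawski, Saito,
  Skinner 2009 Thm. 1: de Rham at `v ∣ ℓ` and local–global compatibility at every finite place,
  for Harris–Taylor's `rec_v` normalised against THE local Artin maps — Skinner 2009 p. 242,
  Harris–Taylor 2001 Introduction), which also supplies the reciprocity datum
  `RD = ⟨llc, hcan, hcanE⟩` with its two canonicity pins,
* `HuTan2015_theorem63` (Kisin 2009 (2.2.18), Paškūnas 2015, Hu–Tan 2015 Thm. 6.3: a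
  crystalline, regular, totally odd, irreducible, residually modular `ρ` with `ρ̄|_{F(ζ_p)}`
  absolutely irreducible is attached to a cuspidal Hilbert eigenform).
Conditional result; it does not close the item (the trust base is printed but unformalised).
[cite: HuTan2015, Thm. 6.3] [cite: Skinner2009, Thm. 1] [cite: Kisin2009, Thm. (2.2.18)] -/
theorem liftB2UnramSplitP_of_pinned_facts
    (hpin : ∀ (F : Type) [Field F] [NumberField F] (p : ℕ) [Fact p.Prime] (m : ℤ)
      (χ : FramedGaloisRep F (PadicAlgCl p) 1),
      (∀ σ, (χ σ).val 0 0 = algebraMap ℚ_[p] (PadicAlgCl p)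
        ((((GaloisRep.cyclotomicCharacter F p σ : ℤ_[p]ˣ) : ℤ_[p]) : ℚ_[p]) ^ m)) →
      ∀ (v : HeightOneSpectrum (𝓞 F)) (hv : ((p : ℕ) : 𝓞 F) ∈ v.asIdeal),
        letI := (fontainePstAdicCompletion v p hv).algebra
        ∀ τ : v.adicCompletion F →ₐ[ℚ_[p]] PadicAlgCl p,
          χ.labelledHodgeTateWeightsAt v (fontainePstAdicCompletion v p hv).algebra
            (fontainePstAdicCompletion v p hv).𝔅 τ.toRingHom = {-m})
    (h27 : exists_galoisRep_of_regularAlgebraic) (hirr : galoisRep_GL2_totallyReal_irreducible)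
    (hLG : galoisRep_GL2_totallyReal_localGlobal_pinned) (hFM : HuTan2015_theorem63) :
    Summit.Langlands.Langlands.Theses.WachComponentCensus.LiftB2UnramSplitP := by
  intro F _ _ _ p _ hp hdisc hsplit
  obtain ⟨llc, hcan, hcanE, hllc⟩ := hLG F ‹IsTotallyReal F›
  refine ⟨⟨llc, hcan, hcanE⟩, ?_, fun hcpt => ⟨?_, ?_⟩⟩
  · -- the pin: Hodge–Tate weights of the powers of the cyclotomic character
    intro m χ hχ v hv
    exact hpin F p m χ hχ v hv
  · -- (A)₂: Galois representations of regular L-algebraic cuspidal `π` on `GL₂ / F`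
    intro π hL hreg ℓ _ ι
    obtain ⟨r, hrirr, hsat⟩ := exists_irreducible_satakeFrobCompatibleAE_GL2 h27 hirr π hL hreg ℓ ι
    obtain ⟨hdR, hLGC⟩ := hllc hcpt π hL hreg ℓ ι r hrirr hsat
    exact ⟨r, hrirr, ⟨hsat.eventually_isUnramifiedAt.mono fun _ h => h.2, hdR⟩, hsat, hLGC⟩
  · -- (B): modularity at the totally split `p` (Kisin, Paškūnas, Hu–Tan), then (A)₂ for `π`
    intro ι ρ hρirr hgeom hodd hcrys hbig hmod
    obtain ⟨π, hL, hreg, hsat⟩ := hFM F ‹IsTotallyReal F› p (le_trans (by norm_num) hp) hdisc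
      hsplit hcpt ι ρ hρirr hgeom.1 hodd hcrys hbig
      (by
        obtain ⟨π₀, ρ₀, h1, h2, h3, h4⟩ := hmod
        exact ⟨π₀, ρ₀, h1, h2, h3.1, h4⟩)
    obtain ⟨-, hLGC⟩ := hllc hcpt π hL hreg p ι ρ hρirr hsat
    exact ⟨π, hL, hsat, hLGC⟩

/-- **Deprecated record.** Formerly `LiftB2UnramSplitP` from the same facts with the UNPINNED
`galoisRep_GL2_totallyReal_localGlobal` (a bare family `llc`, reciprocity datum `⟨llc⟩`).  Since
the 2026-08-16/17 re-type of `ReciprocityData` (fields `llc_isCanonical`, `llc_eps_isCanonical`)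
that family no longer assembles a reciprocity datum — the pins are not derivable from a bare local
Langlands datum — so the name is kept (Theorems files are append-only) as an alias of
`liftB2UnramSplitP_of_pinned_facts`, whose local–global hypothesis is the pinned re-vendoring.
[cite: Skinner2009, Thm. 1] -/
@[deprecated liftB2UnramSplitP_of_pinned_facts (since := "2026-08-17")]
alias liftB2UnramSplitP_of_facts := liftB2UnramSplitP_of_pinned_facts

end Summit.Langlands.Langlands.Theorems

end
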